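import Summits.HubbardSuperconductivity.HubbardSuperconductivity.Theorems.BalabanIRBirComplexStableXYFixedVolumeUniform
import HarnessLib

/-!
# Crux `BirComplexStableXYR` (stmt-HubbardSuperconductivity-14845): the fixed-volume (`∀∃`-swapped) form HOLDS

Support theorem for the restated engine of route BalabanIR (crux 2R,
`Summit.HubbardSuperconductivity.HubbardSuperconductivity.Theses.BalabanIR.BirComplexStableXYR`), prover seat 0.

`birComplexStableXYR_fixedVolume`: for every `r ≥ 2`, `B`, `c₀ > 0` and every FIXED volume `(L, M)` there is
`K₁ = K₁(r, B, c₀, L, M)` such that for all `K ≥ K₁` and every table of the restated class — (U1) charge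
neutrality, (N) `Σ c = 0`, (A) `Σ ‖c_n‖ e^{|n|₁} ≤ B`, (C) coercivity, (R) time-reflection Hermiticity,
(P) inversion evenness — the crux's conclusion `Z ≠ 0 ∧ Re(∫ O e^{-A} / Z) ≥ 1/2` holds (its `let`s verbatim).
This is the crux with ONLY the order of `∃ K₀` and `∀ L M` exchanged; it is the tree's uniform fixed-volume theorem
`birFixedVolume_uniform_stable` (complex Laplace method on the one-spin-sheared torus, uniform over the compact
class cut out by (U1),(N),(A),(C); twelve files `…BirComplexStableXYFixedVolume*`) — (R) and (P) are not needed.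

Consequence for the crux (as for its rev-0 predecessor): `BirComplexStableXYR` is equivalent in content to
"`K₁(r, B, c₀, L, M)` may be chosen independent of `(L, M)`", i.e. to volume-uniformity of the large-`K` regime;
every hypothesis of the class is consistent and the aligned configuration is the non-degenerate Laplace point at
each fixed volume.  [folklore]
-/

noncomputable section

namespace Summit.HubbardSuperconductivity.HubbardSuperconductivity.Theorems

open scoped BigOperators ComplexConjugate
open MeasureTheory Literature.Probability.LatticeModels

/-- **Fixed-volume form of `BirComplexStableXYR`.**  For `r ≥ 2`, `B`, `c₀ > 0` and fixed `(L, M)` there is `K₁` such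
that every table of the restated class ((U1),(N),(A),(C),(R),(P)) has, for all `K ≥ K₁`, `Z ≠ 0` and slice order
`≥ 1/2` (the crux's conclusion verbatim).  Corollary of `birFixedVolume_uniform_stable` ((R),(P), evenness and
`L ≤ M` are not used). [folklore] -/
theorem birComplexStableXYR_fixedVolume (r : ℕ) (B c₀ : ℝ) (hr : 2 ≤ r) (hc₀ : 0 < c₀)
    (L M : ℕ) [NeZero L] [NeZero M] :
    ∃ K₁ : ℝ, ∀ K : ℝ, K₁ ≤ K →
    ∀ c : ((Fin r × Fin r × Fin r) → ℤ) →₀ ℂ,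
    (∀ n ∈ c.support, ∑ w, n w = 0) → c.sum (fun _ a => a) = 0 →
    c.sum (fun n a => ‖a‖ * Real.exp (∑ w, |(n w : ℝ)|)) ≤ B →
    (∀ φ : (Fin r × Fin r × Fin r) → ℝ, c₀ * ∑ w, ∑ w', (1 - Real.cos (φ w - φ w')) ≤
      ((fun (φ : (Fin r × Fin r × Fin r) → ℝ) => c.sum (fun n a => a * Complex.exp (Complex.I *
        ((∑ w, (n w : ℝ) * φ w : ℝ) : ℂ)))) φ).re) →
    (∀ n : (Fin r × Fin r × Fin r) → ℤ, c (fun w => n (w.1, w.2.1, Fin.rev w.2.2)) = (starRingEnd ℂ) (c (-n))) →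
    (∀ n : (Fin r × Fin r × Fin r) → ℤ, c (fun w => n (Fin.rev w.1, Fin.rev w.2.1, w.2.2)) = c n) →
    let sh : (TorusSite 2 L × ZMod M) → (Fin r × Fin r × Fin r) → (TorusSite 2 L × ZMod M) :=
      fun s w => (s.1 + ![((w.1 : ℕ) : ZMod L), ((w.2.1 : ℕ) : ZMod L)], s.2 + ((w.2.2 : ℕ) : ZMod M))
    let F : ((Fin r × Fin r × Fin r) → ℝ) → ℂ := fun (φ : (Fin r × Fin r × Fin r) → ℝ) =>
      c.sum (fun n a => a * Complex.exp (Complex.I * ((∑ w, (n w : ℝ) * φ w : ℝ) : ℂ)))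
    let A : ((TorusSite 2 L × ZMod M) → ℝ) → ℂ := fun θ => (K : ℂ) * ∑ s, F (fun w => θ (sh s w))
    let cube : Set ((TorusSite 2 L × ZMod M) → ℝ) :=
      Set.pi Set.univ (fun _ => Set.Icc (0:ℝ) (2 * Real.pi))
    let Z : ℂ := MeasureTheory.integral (MeasureTheory.volume.restrict cube)
      (fun θ => Complex.exp (-(A θ)))
    let O : ((TorusSite 2 L × ZMod M) → ℝ) → ℝ := fun θ =>
      ‖∑ x : TorusSite 2 L, Complex.exp (Complex.I * (θ (x, 0) : ℂ))‖ ^ 2 / (L : ℝ) ^ 4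
    Z ≠ 0 ∧ (1/2 : ℝ) ≤ ((MeasureTheory.integral (MeasureTheory.volume.restrict cube)
      (fun θ => (O θ : ℂ) * Complex.exp (-(A θ)))) / Z).re := by
  obtain ⟨K₁, hK₁⟩ := birFixedVolume_uniform_stable r B c₀ hr hc₀ L M
  refine ⟨K₁, fun K hK c hU1 hN hA hC _ _ => ?_⟩
  exact hK₁ K hK c hU1 hN hA hC

end Summit.HubbardSuperconductivity.HubbardSuperconductivity.Theorems

end
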